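import Literature.Analysis.FunctionSpaces.SobolevTraceDensityProofs
import HarnessLib

/-!
# Discharged fact: finiteness of the Sobolev norm characterises `W^{k,p}(Ω)`

`Literature.Analysis.FunctionSpaces.SobolevDomain` defines membership in the Sobolev space
`Literature.MemSobolevDomain k p Ω μ f` (`f ∈ W^{k,p}(Ω; F)`, by recursion on `k` through weak
derivatives `Literature.Analysis.FunctionSpaces.HasWeakFDerivOn`) and the extended Sobolev norm
`Literature.eSobolevDomainNorm k p Ω μ f : ℝ≥0∞`, and records as a named fact
`Literature.Analysis.FunctionSpaces.eSobolevDomainNorm_lt_top_iff` that, for `f` a.e.-strongly measurable on `Ω`,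
`‖f‖_{W^{k,p}(Ω)} < ∞ ↔ f ∈ W^{k,p}(Ω)`. This file proves it:

* `Literature.eSobolevDomainNorm_lt_top_iff_holds : eSobolevDomainNorm_lt_top_iff`.

Source: Brezis, *Functional Analysis, Sobolev Spaces and Partial Differential Equations* (2011),
§9.1, Definition p. 263 — `W^{1,p}(Ω) = {u ∈ L^p(Ω) : ∃ g₁, …, g_N ∈ L^p(Ω), ∫_Ω u ∂ᵢφ =
-∫_Ω gᵢ φ ∀ φ ∈ C_c^∞(Ω), ∀ i}` with the norm `‖u‖_{W^{1,p}} = ‖u‖_p + Σᵢ ‖∂u/∂xᵢ‖_p` — and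
"The spaces `W^{m,p}(Ω)`", p. 271 — `W^{m,p}(Ω) = {u ∈ W^{m-1,p}(Ω) : ∂u/∂xᵢ ∈ W^{m-1,p}(Ω) ∀ i}`.
In the source the norm is defined *on* the space; in Lean the extended norm is defined on all
functions (value `∞` off the space for `k ≥ 1`), and the theorem is the bridge between the two.
There is no printed proof to follow (the statement is definition-level in the source); the
proof here is by induction on `k`, and needs the vector-space closure properties of
`HasWeakFDerivOn` and `MemSobolevDomain` (Brezis, §9.1, Proposition 9.1: `W^{1,p}(Ω)` is a
Banach space). Zero, sums, negation and differences of weak derivatives and of `W^{k,p}(Ω)`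
functions are already proved in `Literature.SobolevApprox` (`SobolevTraceDensityProofs`, Part I:
`hasWeakFDerivOn_zero/_add`, `memSobolevDomain_add`, `locallyIntegrableOn_deriv_apply`), which
this file imports and uses; it adds only what is missing there:

* `Literature.Analysis.FunctionSpaces.HasWeakFDerivOn.const_smul`, `Literature.MemSobolevDomain.zero/.const_smul/.sum`;
* `Literature.Analysis.FunctionSpaces.HasWeakFDerivOn.aestronglyMeasurable_deriv_apply`, `Literature.Analysis.FunctionSpaces.eSobolevDomainNorm_succ`.

## Proof of the main theorem

Induction on `k` (for all `f`). `k = 0`: `MemLp = AEStronglyMeasurable ∧ eLpNorm < ∞`.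
`k + 1`, (→): `‖f‖_p + inf_g Σᵢ ‖g eᵢ‖_{W^{k,p}}` is finite iff both summands are; a finite
infimum is witnessed by some weak derivative `g` with `Σᵢ ‖g eᵢ‖_{W^{k,p}} < ∞`, so each
`g eᵢ ∈ W^{k,p}` by induction (components of `g` are measurable, being locally integrable), and
then every component `g v = Σᵢ vᵢ • g eᵢ` lies in `W^{k,p}` because `W^{k,p}(Ω)` is a vector
space. (←): the infimum is at most its value at the weak derivative provided by membership, a
finite sum of terms finite by induction.

(History: this discharge was first accepted into `SobolevDomainProofs.lean` as p5829 and was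
lost to a concurrent whole-file proposal of that file; it lives in its own module so that this
cannot recur.)

## References

* H. Brezis, *Functional Analysis, Sobolev Spaces and Partial Differential Equations*,
  Universitext, Springer (2011), §9.1, pp. 263 and 271, Proposition 9.1.
  doi:10.1007/978-0-387-70914-7
-/

noncomputable section

open MeasureTheory TopologicalSpace
open scoped ENNReal

namespace Literature.Analysis.FunctionSpaces

variable {E' : Type*} [NormedAddCommGroup E'] [NormedSpace ℝ E'] [MeasurableSpace E']
variable {F : Type*} [NormedAddCommGroup F] [NormedSpace ℝ F]

/-- Weak derivatives are homogeneous: if `g` is a weak derivative of `f` on `Ω` then `c • g` is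
one of `c • f` (pull the scalar out of both integrals). (Brezis, §9.1, Proposition 9.1:
`W^{1,p}(Ω)` is a vector space.) [folklore] -/
theorem HasWeakFDerivOn.const_smul {Ω : Opens E'} {μ : Measure E'} {f : E' → F}
    {g : E' → E' →L[ℝ] F} (h : HasWeakFDerivOn Ω μ f g) (c : ℝ) :
    HasWeakFDerivOn Ω μ (c • f) (c • g) := by
  refine ⟨h.locallyIntegrableOn.smul c, h.locallyIntegrableOn_deriv.smul c, fun φ v hφ => ?_⟩
  have e₁ : (fun x => fderiv ℝ φ x v • (c • f) x) = fun x => c • (fderiv ℝ φ x v • f x) :=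
    funext fun x => smul_comm _ _ _
  have e₂ : (fun x => φ x • (c • g) x v) = fun x => c • (φ x • g x v) := by
    funext x; simp only [Pi.smul_apply, _root_.smul_apply, smul_comm (φ x) c]
  rw [e₁, e₂, integral_smul, integral_smul, h.integral_fderiv_smul_eq φ v hφ, smul_neg]

/-- `0 ∈ W^{k,p}(Ω)` (Brezis, §9.1, Proposition 9.1, and "The spaces `W^{m,p}(Ω)`", p. 271:
`W^{m,p}(Ω)` is a Banach space, in particular a vector space). [folklore] -/
theorem MemSobolevDomain.zero (k : ℕ) (p : ℝ≥0∞) (Ω : Opens E') (μ : Measure E') :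
    MemSobolevDomain k p Ω μ (0 : E' → F) := by
  induction k with
  | zero => exact MemLp.zero
  | succ k ih => exact ⟨MemLp.zero, 0, SobolevApprox.hasWeakFDerivOn_zero, fun _ => ih⟩

/-- `W^{k,p}(Ω)` is closed under scalar multiplication (Brezis, §9.1, Proposition 9.1 and
p. 271); by induction on `k` (`HasWeakFDerivOn.const_smul`). [folklore] -/
theorem MemSobolevDomain.const_smul {k : ℕ} {p : ℝ≥0∞} {Ω : Opens E'} {μ : Measure E'}
    {f : E' → F} (h : MemSobolevDomain k p Ω μ f) (c : ℝ) :
    MemSobolevDomain k p Ω μ (c • f) := by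
  induction k generalizing f with
  | zero => exact MemLp.const_smul h c
  | succ k ih =>
    obtain ⟨hf, g, hg, hv⟩ := h
    exact ⟨hf.const_smul c, c • g, hg.const_smul c, fun v => ih (hv v)⟩

/-- `W^{k,p}(Ω)` is closed under finite sums (Brezis, §9.1, Proposition 9.1 and p. 271:
`W^{m,p}(Ω)` is a Banach space, in particular a vector space; from
`SobolevApprox.memSobolevDomain_add`). [folklore] -/
theorem MemSobolevDomain.sum [OpensMeasurableSpace E'] {ι : Type*} {k : ℕ} {p : ℝ≥0∞}
    {Ω : Opens E'} {μ : Measure E'} {u : ι → E' → F} {s : Finset ι}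
    (h : ∀ i ∈ s, MemSobolevDomain k p Ω μ (u i)) :
    MemSobolevDomain k p Ω μ (∑ i ∈ s, u i) :=
  Finset.sum_induction u (MemSobolevDomain k p Ω μ)
    (fun _ _ ha hb => SobolevApprox.memSobolevDomain_add ha hb) (MemSobolevDomain.zero k p Ω μ) h

/-- The components `x ↦ g x v` of a weak derivative on `Ω` are a.e.-strongly measurable on `Ω`
(they are locally integrable there, `SobolevApprox.locallyIntegrableOn_deriv_apply`). [folklore] -/
theorem HasWeakFDerivOn.aestronglyMeasurable_deriv_apply [SecondCountableTopology E']
    {Ω : Opens E'} {μ : Measure E'} {f : E' → F} {g : E' → E' →L[ℝ] F}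
    (h : HasWeakFDerivOn Ω μ f g) (v : E') :
    AEStronglyMeasurable (fun x => g x v) (μ.restrict (Ω : Set E')) :=
  (SobolevApprox.locallyIntegrableOn_deriv_apply h v).aestronglyMeasurable

/-- Unfolding `‖f‖_{W^{k+1,p}(Ω)} = ‖f‖_{L^p(Ω)} + inf_g Σᵢ ‖g eᵢ‖_{W^{k,p}(Ω)}`
(Brezis, §9.1, p. 263 and p. 271). [folklore] -/
theorem eSobolevDomainNorm_succ [FiniteDimensional ℝ E'] {k : ℕ} {p : ℝ≥0∞} {Ω : Opens E'}
    {μ : Measure E'} {f : E' → F} :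
    eSobolevDomainNorm (k + 1) p Ω μ f = eLpNorm f p (μ.restrict Ω) +
      ⨅ (g : E' → E' →L[ℝ] F) (_ : HasWeakFDerivOn Ω μ f g),
        ∑ i, eSobolevDomainNorm k p Ω μ (fun x => g x (Module.finBasis ℝ E' i)) := rfl

/-- **Discharge of `eSobolevDomainNorm_lt_top_iff`.** For `f` a.e.-strongly measurable on `Ω`,
`‖f‖_{W^{k,p}(Ω)} < ∞ ↔ f ∈ W^{k,p}(Ω)`. Source: Brezis, *Functional Analysis, Sobolev Spaces
and PDE* (2011), §9.1, Definition p. 263 — `W^{1,p}(Ω) = {u ∈ L^p(Ω) : ∃ g₁, …, g_N ∈ L^p(Ω),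
∫_Ω u ∂ᵢφ = -∫_Ω gᵢ φ ∀ φ ∈ C_c^∞(Ω), ∀ i}` with the norm `‖u‖_{W^{1,p}} = ‖u‖_p + Σᵢ ‖∂u/∂xᵢ‖_p`
— and "The spaces `W^{m,p}(Ω)`", p. 271 — `W^{m,p}(Ω) = {u ∈ W^{m-1,p}(Ω) : ∂u/∂xᵢ ∈
W^{m-1,p}(Ω) ∀ i}`. There the norm is defined *on* the space; here the extended norm is defined
on all functions (value `∞` off the space for `k ≥ 1`), and this theorem is the bridge.

Proof by induction on `k` (for all `f`). `k = 0`: `MemLp = AEStronglyMeasurable ∧ eLpNorm < ∞`.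
`k + 1`, (→): the sum is finite iff both summands are; a finite infimum is witnessed by some
weak derivative `g` with `Σᵢ ‖g eᵢ‖_{W^{k,p}} < ∞`, so each `g eᵢ ∈ W^{k,p}` by induction
(components of `g` are measurable, being locally integrable), and then every component
`g v = Σᵢ vᵢ • g eᵢ` lies in `W^{k,p}` because `W^{k,p}(Ω)` is a vector space
(`MemSobolevDomain.sum`, `.const_smul`). (←): the infimum is at most its value at the weak
derivative provided by membership, a finite sum of terms finite by induction. [cite: Brezis2011, §9.1, Definition p. 263 (W^{1,p}(Ω) and its norm) and "The spaces W^{m,p}(Ω)" p. 271] -/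
theorem eSobolevDomainNorm_lt_top_iff_holds [FiniteDimensional ℝ E'] :
    eSobolevDomainNorm_lt_top_iff (E' := E') (F := F) := by
  intro k
  induction k with
  | zero =>
    intro p Ω μ _ f hf
    rw [eSobolevDomainNorm_zero, memSobolevDomain_zero_iff]
    exact ⟨fun h => ⟨hf, h⟩, fun h => h.eLpNorm_lt_top⟩
  | succ k ih =>
    intro p Ω μ _ f hf
    rw [eSobolevDomainNorm_succ, memSobolevDomain_succ_iff, ENNReal.add_lt_top]
    set b := Module.finBasis ℝ E'
    constructor
    · rintro ⟨h0, h1⟩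
      obtain ⟨g, hg⟩ := iInf_lt_iff.1 h1
      obtain ⟨hgw, hsum⟩ := iInf_lt_iff.1 hg
      have hi : ∀ i, MemSobolevDomain k p Ω μ (fun x => g x (b i)) := fun i =>
        (ih (hgw.aestronglyMeasurable_deriv_apply (b i))).1
          (ENNReal.sum_lt_top.1 hsum i (Finset.mem_univ i))
      refine ⟨⟨hf, h0⟩, g, hgw, fun v => ?_⟩
      have hv : (fun x => g x v) = ∑ i, b.repr v i • fun x => g x (b i) := by
        funext x
        conv_lhs => rw [← b.sum_repr v]
        simp only [map_sum, map_smul, Finset.sum_apply, Pi.smul_apply]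
      rw [hv]
      exact MemSobolevDomain.sum fun i _ => (hi i).const_smul _
    · rintro ⟨h0, g, hgw, hgv⟩
      refine ⟨h0.eLpNorm_lt_top, lt_of_le_of_lt (iInf₂_le g hgw) ?_⟩
      exact ENNReal.sum_lt_top.2 fun i _ =>
        (ih (hgv (b i)).memLp.aestronglyMeasurable).2 (hgv (b i))

end Literature.Analysis.FunctionSpaces
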